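import Literature.NumberTheory.Automorphic.ResGLnConeDictionaryCone
import HarnessLib

/-!
# The Borel–Wallach dictionary in the cone model, III: the dictionary is injective —
# a cochain whose cone forms all vanish is zero

Topic `NumberTheory/Automorphic`; namespace `Literature.NumberTheory.Automorphic.ConeDictionary`
(sequel of `ResGLnConeDictionary`, `ResGLnConeDictionaryCone`).  Theorems only; no definition, no
named fact, no `sorry`.

For a cochain `η ∈ C^{q+1}(𝔤, K_∞; W ⊗ (E_λ ⊗ ε_S))` of the `(𝔤, K_∞)`-complex `gkComplexLS π S λ`
of an automorphic representation `π` of `GL_n(𝔸_K)` (space `W` of automorphic FUNCTIONS):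

* `leftFormAlg_eq_zero_of_coneForm_eq_zero` — if the cone form `ω_c = coneForm π S λ η c` vanishes
  on the positive cone then the left form `Y ↦ E(g) η(Y)(g, c)` vanishes at EVERY `g ∈ G_∞`: the
  pullback identity `p^* ω = ω̃` (`coneForm_apply_tangent`) at `H = g gᴴ ∈ X⁺`, and `g⁻¹ (g Y) = Y`;
* `evalTensor_apply_adelicPt_eq_zero_of_coneForm_eq_zero` — hence every value `η(X₁, …) ∈ W ⊗ E`,
  read as an `E`-valued function, vanishes at the adelic point `(g, c)` (`E(g)` is invertible);
* `exists_eq_sum_tmul`, `eq_zero_of_evalTensor_eq_zero` — an element of `W ⊗ E` whose `E`-valued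
  function vanishes identically is zero (`E` finite-dimensional: expand in a basis of `E`, linear
  independence, and `W` consists of functions);
* **`eq_zero_of_forall_coneForm_eq_zero`** — THE DICTIONARY IS INJECTIVE: if `ω_c(H) = 0` for all
  finite-adelic `c` and all `H` in the positive cone, then `η = 0` (every adelic point is
  `(g_∞, c_f)`, `GLn.ofInfinite_toMixed_mul_ofFinite_sndHom`).

This is the last clause of Borel's injectivity of cuspidal cohomology through the cone periods
(`ResGLnCuspidalCohomologyApex`, fact `Borel1983_coneClass_ne_zero`, Step 4: the energy argument
gives `ω_c = 0` for every `c`, whence `η = 0`, contradicting `η ∉ B`).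
[cite: BorelWallach2000, VII 2.2–2.7]

## References

* A. Borel, N. Wallach, *Continuous cohomology, discrete subgroups, and representations of reductive
  groups*, 2nd ed. (2000), VII 2.2–2.7 (the identification `ω ↦ ω⁰` is bijective). [BorelWallach2000]
* A. Borel, H. Jacquet, Corvallis (1979), §4.1 (`g = g_∞ g_f`). [BorelJacquet1979]
-/

noncomputable section

namespace Literature.NumberTheory.Automorphic

open scoped TensorProduct MatrixGroups Classical _root_.Matrix
open _root_.NumberField _root_.NumberField.mixedEmbedding RealMatrixGroup

namespace ConeDictionary

variable {n : ℕ} {K : Type} [Field K] [NumberField K] {hcpt : isCompact_glFiniteIntegralLevel n K}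
  (π : AutomorphicRepData (AutomorphyDatum.gl n K hcpt))
  (S : Finset {w : InfinitePlace K // w.IsReal}) (lam : (K →+* ℂ) → Fin n → ℤ) {q : ℕ}

/-! ### From the cone to the group: `ω_c = 0` on `X⁺` forces the left form to vanish on `G_∞` -/

/-- **`ω_c = 0` on the positive cone ⇒ the left form vanishes at every `g ∈ G_∞`**:
`E(g) η(Y₁, …)(g, c) = 0` for all matrices `Yᵢ` — the pullback identity `p^* ω = ω̃` at
`H = g gᴴ = g · 1 · gᴴ ∈ X⁺` applied to `g Yᵢ`, and `g⁻¹ (g Yᵢ) = Yᵢ`.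
[cite: BorelWallach2000, VII 2.2–2.4] -/
theorem leftFormAlg_eq_zero_of_coneForm_eq_zero {η : Cochain π lam (q + 1)}
    (hη : η ∈ (gkComplexLS π S lam).carrier (q + 1)) (c : BigHeckeGLn.FiniteAdelicGL n K)
    (hzero : ∀ H ∈ ResGLnCone.posCone n K, coneForm π S lam η c H = 0)
    (g : (AutomorphyDatum.gl n K hcpt).arch.carrier) (Y : Fin (q + 1) → Matrix (Fin n) (Fin n) (mixedSpace K)) :
    leftFormAlg π S lam η c g Y = 0 := by
  -- the matrix of `g`, the point `H = g gᴴ` of the cone, the tangent vectors `(gYᵢ) gᴴ + g (gYᵢ)ᴴ`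
  set gM : Matrix (Fin n) (Fin n) (mixedSpace K) :=
    (((g : (AutomorphyDatum.gl n K hcpt).arch.carrier) : GL (Fin n) (mixedSpace K)) : Matrix (Fin n) (Fin n) (mixedSpace K))
    with hgM
  have hH : gM * gMᴴ = ((ResGLnCone.coneAction n K ((g : (AutomorphyDatum.gl n K hcpt).arch.carrier) :
      GL (Fin n) (mixedSpace K)) (ResGLnCone.hermOne n K) : ResGLnCone.hermSpace n K) :
        Matrix (Fin n) (Fin n) (mixedSpace K)) := by
    rw [ResGLnCone.coe_coneAction, ResGLnCone.coe_hermOne, Matrix.mul_one]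
  have hmem : ResGLnCone.coneAction n K ((g : (AutomorphyDatum.gl n K hcpt).arch.carrier) :
      GL (Fin n) (mixedSpace K)) (ResGLnCone.hermOne n K) ∈ ResGLnCone.posCone n K :=
    ResGLnCone.mapsTo_coneAction_posCone n K _ (ResGLnCone.hermOne_mem_posCone n K)
  have hvmem : ∀ i, gM * Y i * gMᴴ + gM * (gM * Y i)ᴴ ∈ ResGLnCone.hermSpace n K := fun i => by
    rw [ResGLnCone.mem_hermSpace_iff, Matrix.conjTranspose_add]
    have e1 : (gM * Y i * gMᴴ)ᴴ = gM * (gM * Y i)ᴴ := by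
      rw [Matrix.conjTranspose_mul, Matrix.conjTranspose_conjTranspose]
    have e2 : (gM * (gM * Y i)ᴴ)ᴴ = gM * Y i * gMᴴ := by
      rw [Matrix.conjTranspose_mul, Matrix.conjTranspose_conjTranspose]
    rw [e1, e2, add_comm]
  have key := coneForm_apply_tangent π S lam hη c g hH (fun i => gM * Y i)
    (fun i => ⟨gM * Y i * gMᴴ + gM * (gM * Y i)ᴴ, hvmem i⟩) (fun i => rfl)
  rw [hzero _ hmem] at key
  have key' : leftTrivForm π S lam η c gM (fun i => gM * Y i) = 0 := by
    rw [← key]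
    rfl
  rw [leftTrivForm_apply, leftForm_apply, archOfMatrix_coe_datum] at key'
  have hinv : (fun i => Ring.inverse gM * (gM * Y i)) = Y := by
    funext i
    rw [hgM, Ring.inverse_unit, Units.inv_mul_cancel_left]
  rw [hinv] at key'
  exact key'

/-- **Hence every value of `η` vanishes at the adelic point `(g, c)`**:
`evalTensor (η X) (g, c) = 0` (`E(g)` is invertible). [cite: BorelWallach2000, VII 2.2] -/
theorem evalTensor_apply_adelicPt_eq_zero_of_coneForm_eq_zero {η : Cochain π lam (q + 1)}
    (hη : η ∈ (gkComplexLS π S lam).carrier (q + 1)) (c : BigHeckeGLn.FiniteAdelicGL n K)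
    (hzero : ∀ H ∈ ResGLnCone.posCone n K, coneForm π S lam η c H = 0)
    (g : (AutomorphyDatum.gl n K hcpt).arch.carrier) (X : Fin (q + 1) → (AutomorphyDatum.gl n K hcpt).arch.lie) :
    π.evalTensor (ResGLnCohomology.CoeffModule ℂ n K lam)
        (@id (π.W ⊗[ℂ] ResGLnCohomology.CoeffModule ℂ n K lam) (η X)) (adelicPt hcpt g c) = 0 := by
  have h := leftFormAlg_eq_zero_of_coneForm_eq_zero π S lam hη c hzero g
    (fun i => ((X i : (AutomorphyDatum.gl n K hcpt).arch.lie) : Matrix (Fin n) (Fin n) (mixedSpace K)))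
  rw [leftFormAlg_apply, twistedEval_apply] at h
  simp only [toLie_coe] at h
  -- `E(g)` is injective: apply `E(g⁻¹)`
  have h2 := congrArg (σS hcpt S lam g⁻¹) h
  rwa [map_zero, ← Module.End.mul_apply, ← map_mul, inv_mul_cancel, map_one, Module.End.one_apply] at h2

/-! ### `W ⊗ E` as `E`-valued functions: the evaluation is injective -/

/-- Every element of `W ⊗ E` is `∑ᵢ wᵢ ⊗ bᵢ` for a basis `(bᵢ)` of the finite-dimensional `E`.
[folklore] -/
theorem exists_eq_sum_tmul {E : Type*} [AddCommGroup E] [Module ℂ E] {ι : Type*} [Fintype ι]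
    (b : Module.Basis ι ℂ E) (t : π.W ⊗[ℂ] E) : ∃ u : ι → π.W, t = ∑ i, u i ⊗ₜ[ℂ] b i := by
  induction t using TensorProduct.induction_on with
  | zero => exact ⟨fun _ => 0, (Finset.sum_eq_zero fun i _ => by exact TensorProduct.zero_tmul _ (b i)).symm⟩
  | tmul w e =>
    refine ⟨fun i => b.repr e i • w, ?_⟩
    conv_lhs => rw [← b.sum_repr e]
    rw [TensorProduct.tmul_sum]
    refine Finset.sum_congr rfl fun i _ => ?_
    rw [TensorProduct.tmul_smul, TensorProduct.smul_tmul']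
  | add t t' ht ht' =>
    obtain ⟨u, rfl⟩ := ht
    obtain ⟨u', rfl⟩ := ht'
    exact ⟨u + u', by simp only [Pi.add_apply, TensorProduct.add_tmul, Finset.sum_add_distrib]⟩

/-- **An element of `W ⊗ E` whose `E`-valued function vanishes identically is zero** (`E`
finite-dimensional; `W` is a space of functions). [cite: BorelWallach2000, VII 2.2] -/
theorem eq_zero_of_evalTensor_eq_zero {E : Type*} [AddCommGroup E] [Module ℂ E] [FiniteDimensional ℂ E]
    (t : π.W ⊗[ℂ] E) (ht : π.evalTensor E t = 0) : t = 0 := by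
  obtain ⟨u, rfl⟩ := exists_eq_sum_tmul π (Module.finBasis ℂ E) t
  -- at every adelic point the coordinates vanish
  have hcoord : ∀ x i, ((u i : π.W) : (AdelicGroupData.gl n K).Adelic → ℂ) x = 0 := by
    intro x
    have hx := congrArg (fun F => F x) ht
    simp only [map_sum, Finset.sum_apply, AutomorphicRepData.evalTensor_tmul, Pi.zero_apply] at hx
    exact (Fintype.linearIndependent_iff.1 (Module.finBasis ℂ E).linearIndependent) _ hx
  have hu : ∀ i, u i = 0 := fun i => Subtype.ext (funext fun x => hcoord x i)
  exact Finset.sum_eq_zero fun i _ => by rw [hu i]; exact TensorProduct.zero_tmul _ _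

/-! ### The dictionary is injective -/

/-- **A cochain all of whose cone forms vanish is zero**: if `coneForm π S λ η c H = 0` for every
finite-adelic `c` and every `H` in the positive cone, then `η = 0` — every adelic point is
`(g_∞, c_f)` [cite: BorelJacquet1979, §4.1], so every value of `η` vanishes as an `E`-valued
function, hence in `W ⊗ E`.  (The map `η ↦ ω(η)` of [cite: BorelWallach2000, VII 2.2–2.7] is
injective; used in the last step of Borel's injectivity of cuspidal cohomology through the cone
periods, `Borel1983_coneClass_ne_zero`.) -/
theorem eq_zero_of_forall_coneForm_eq_zero {η : Cochain π lam (q + 1)}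
    (hη : η ∈ (gkComplexLS π S lam).carrier (q + 1))
    (hzero : ∀ (c : BigHeckeGLn.FiniteAdelicGL n K), ∀ H ∈ ResGLnCone.posCone n K, coneForm π S lam η c H = 0) :
    η = 0 := by
  ext X
  change @id (π.W ⊗[ℂ] ResGLnCohomology.CoeffModule ℂ n K lam) (η X) = 0
  haveI : FiniteDimensional ℂ (ResGLnCohomology.CoeffModule ℂ n K lam) :=
    ResGLnCohomology.finiteDimensional_coeffModule n K lam
  refine eq_zero_of_evalTensor_eq_zero π _ (funext fun x => ?_)
  -- `x = (x_∞, 1) (1, x_f)`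
  let g : (AutomorphyDatum.gl n K hcpt).arch.carrier := ⟨GLn.toMixed n K x, Subgroup.mem_top _⟩
  have hx : adelicPt hcpt g (GLn.sndHom n K x) = x := by
    rw [adelicPt, AutomorphyDatum.gl_ofArch_apply]
    exact GLn.ofInfinite_toMixed_mul_ofFinite_sndHom x
  rw [Pi.zero_apply, ← hx]
  exact evalTensor_apply_adelicPt_eq_zero_of_coneForm_eq_zero π S lam hη _ (hzero _) g X

end ConeDictionary

end Literature.NumberTheory.Automorphic

end
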